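import Mathlib
import Literature.NumberTheory.DiophantineGeometry.SchurWeylPlethysmOrbitWeightsProofs

/-!
# Evaluation-rank lower bound for orbit-closure multiplicities (siege stub, attempt k3)

Stub `stub_evalRankLowerBound` of crux `ValuativeGCT.ValuativeFlip` (stmt-ValiantsHypothesis-12624,
`Cruxes/ValuativeFlip/SiegeStubs.lean`): if `F₁ … F_D ∈ ℂ[Sym^m ℂ^σ]` are highest-weight vectors of
weight `χ` (`coordRep`) and the evaluation matrix `(F_i(A_l · f))_{i,l}` at `D` endomorphism-orbit
points `A_l · f` (`A_l` ANY matrices, singular allowed) is nonsingular, then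
`D ≤ mult_χ ℂ[Δ_m(f)] = orbitMultiplicity ℂ f m χ` (`m ≠ 0`).

Proof = reduction to landed lemmas, then assembly:
* the classes `[F_i] ∈ ℂ[Δ_m(f)] = ℂ[Sym^m] ⧸ I(GL · f)` are highest-weight vectors of weight `χ`
  (the quotient map is `GL`-equivariant: `orbitCoordRep_apply`, `orbitCoordSubst_mk`,
  `coordRep_apply`);
* they are linearly independent: a relation `∑ c_i F_i ∈ I(GL · f)` lies in the kernel of the
  generic orbit map (`orbitVanishingIdeal_eq_ker_genericOrbitMap`, `GL` Zariski dense in `Mat`), so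
  it vanishes at EVERY matrix point `A · f` (`aeval_genericOrbitMap`), in particular at the `A_l`;
  i.e. `c ᵥ* M = 0`, so `c = 0` (`Matrix.eq_zero_of_vecMul_eq_zero`);
* the highest-weight space is finite-dimensional for `m ≠ 0`
  (`finiteDimensional_highestWeightSpace_orbitCoordRep_holds`), so `D ≤ finrank`
  (`LinearIndependent.fintype_card_le_finrank`).
[MulmuleySohoni2001 §4–5; BLMW2011 §5.2; folklore]
-/

set_option linter.dupNamespace false

namespace Summit.ValiantsHypothesis.ValiantsHypothesis.Theorems.ValuativeFlip

open MvPolynomial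
open scoped BigOperators Matrix
open Literature.NumberTheory.DiophantineGeometry Literature.Computability.AlgebraicComplexity

noncomputable section

/-- **Evaluation-rank lower bound** (per-side engine of crux `ValuativeFlip`).  Let `f ∈ ℂ[x_σ]`,
`m ≠ 0`, `χ` a weight, `F₁ … F_D` highest-weight vectors of weight `χ` in `ℂ[Sym^m ℂ^σ]`
(`coordRep σ ℂ m`) and `A₁ … A_D` any matrices.  If the evaluation matrix `(F_i(A_l · f))_{i,l}` is
nonsingular then `D ≤ orbitMultiplicity ℂ f m χ`: the classes of the `F_i` in
`ℂ[Δ_m(f)] = ℂ[Sym^m] ⧸ I(GL · f)` are highest-weight vectors of weight `χ`, linearly independent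
because a vanishing combination lies in `I(GL · f) = ker (generic orbit map)` and therefore vanishes
at every `A_l · f`, and the highest-weight space is finite-dimensional for `m ≠ 0`.
[MulmuleySohoni2001 §4–5; BLMW2011 §5.2; folklore] -/
theorem stub_evalRankLowerBound :
    ∀ {σ : Type} [Fintype σ] [LinearOrder σ] (f : MvPolynomial σ ℂ) (m : ℕ), m ≠ 0 →
      ∀ (χ : Weight σ) (D : ℕ) (F : Fin D → MvPolynomial (DegIdx σ m) ℂ),
        (∀ i, F i ∈ highestWeightSpace (coordRep σ ℂ m) χ) →
        ∀ (A : Fin D → Matrix σ σ ℂ),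
          (Matrix.of fun i l : Fin D => MvPolynomial.aeval (formCoeff m (linSubst σ ℂ (A l) f)) (F i)).det ≠ 0 →
          D ≤ orbitMultiplicity ℂ f m χ := by
  intro σ _ _ f m hm χ D F hF A hdet
  -- the classes `[F_i]` are highest-weight vectors of weight `χ` in `ℂ[Δ_m(f)]`
  have hmk : ∀ i, (Ideal.Quotient.mk (orbitVanishingIdeal f m) (F i) : OrbitCoordRing f m) ∈
      highestWeightSpace (orbitCoordRep f m) χ := by
    intro i g hg
    rw [orbitCoordRep_apply, orbitCoordSubst_mk, ← coordRep_apply, hF i g hg]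
    rw [← Ideal.Quotient.mkₐ_eq_mk ℂ, map_smul]
  -- an element of `I(GL · f)` vanishes at `B · f` for EVERY matrix `B` (singular allowed)
  have hvan : ∀ {G : MvPolynomial (DegIdx σ m) ℂ}, G ∈ orbitVanishingIdeal f m →
      ∀ B : Matrix σ σ ℂ, aeval (formCoeff m (linSubst σ ℂ B f)) G = 0 := by
    intro G hG B
    rw [orbitVanishingIdeal_eq_ker_genericOrbitMap, RingHom.mem_ker] at hG
    have h1 := aeval_genericOrbitMap f m G B
    rw [hG, map_zero] at h1
    exact h1.symm
  -- the classes `[F_i]` are linearly independent in `ℂ[Δ_m(f)]`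
  have hli : LinearIndependent ℂ fun i =>
      (Ideal.Quotient.mk (orbitVanishingIdeal f m) (F i) : OrbitCoordRing f m) := by
    rw [Fintype.linearIndependent_iff]
    intro c hc i
    have hmem : ∑ j, c j • F j ∈ orbitVanishingIdeal f m := by
      rw [← Ideal.Quotient.eq_zero_iff_mem, ← Ideal.Quotient.mkₐ_eq_mk ℂ, map_sum]
      simp only [map_smul, Ideal.Quotient.mkₐ_eq_mk]
      exact hc
    have hvec : c ᵥ* (Matrix.of fun i l : Fin D =>
        MvPolynomial.aeval (formCoeff m (linSubst σ ℂ (A l) f)) (F i)) = 0 := by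
      funext l
      have h1 := hvan hmem (A l)
      rw [map_sum] at h1
      simp only [map_smul, smul_eq_mul] at h1
      rw [Pi.zero_apply, ← h1]
      rfl
    exact congr_fun (Matrix.eq_zero_of_vecMul_eq_zero hdet hvec) i
  -- lift to the highest-weight space
  have hv : LinearIndependent ℂ fun i =>
      (⟨Ideal.Quotient.mk (orbitVanishingIdeal f m) (F i), hmk i⟩ :
        ↥(highestWeightSpace (orbitCoordRep f m) χ)) :=
    LinearIndependent.of_comp (highestWeightSpace (orbitCoordRep f m) χ).subtype hli
  -- the highest-weight space is finite-dimensional (`m ≠ 0`)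
  haveI : FiniteDimensional ℂ ↥(highestWeightSpace (orbitCoordRep f m) χ) :=
    finiteDimensional_highestWeightSpace_orbitCoordRep_holds f hm χ
  have hcard := hv.fintype_card_le_finrank
  rw [Fintype.card_fin] at hcard
  unfold orbitMultiplicity hwMultiplicity
  exact hcard

end

end Summit.ValiantsHypothesis.ValiantsHypothesis.Theorems.ValuativeFlip
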